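import Literature.Algebra.Polynomial.CircuitNormMinimiser

/-!
# Zeros of boundary circuit polynomials: the norm minimiser is the unique zero

[cite: IlimanDewolff2016, §3.2 («we define s*_f ∈ ℝⁿ as the unique vector satisfying
`e^{⟨s*_f, α(j)⟩} = λ_j / b_j` for all `1 ≤ j ≤ n`»; «the rank of this system has to be n, since
conv(A) is a simplex»), Proposition 13 (arXiv numbering: «For `f ∈ P_Δ^y` and `c = −Θ_f` the point
`s* ∈ ℝⁿ` is a root and the unique global minimizer of `f(e^w)`»), Corollary 18 (arXiv numbering;
«Let `f ∈ ∂P_{n,2d}^y`. Then `f` has at most `2ⁿ` affine real zeros `v ∈ ℝⁿ`, which all satisfy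
`|x_j| = e^{s_j^*}`», proof: «we know by the proof of Theorem (Thm:Positiv) that
`|x_j| = e^{s_j^*}`. Thus, `x = (± e^{s_1^*}, …, ± e^{s_n^*})`»), and the example after it (the
Motzkin polynomial: «the zero `s* = (0,0)` is the only root of `f(e^s)` … with Corollary
(zerobound) it follows that every root `(v_1, v_2) ∈ (ℝ*)²` of `f` satisfies
`|v_j| = e^0 = 1`», i.e. the bound `2ⁿ` is attained)]

The companion files prove the circuit-number criterion ([IlimanDewolff2016, Thm. 3.8]) in both
directions (`CircuitNumberNonnegativity`, `CircuitNumberTightness`, `CircuitNormMinimiser`): for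
`b, λ > 0`, `∑ λ_j = 1`, `β = ∑ λ_j α(j)`,
`g_c(x) = ∑_j b_j e^{α(j)·x} + c e^{β·x} ≥ 0 on ℝⁿ ⟺ −Θ(b, λ) ≤ c`, and an EQUALISING POINT
`x*` (`b_j e^{α(j)·x*} = λ_j Θ e^{β·x*}` for all `j`; the log of the norm minimiser `e^{s*}` of the
source) exists whenever the outer exponents are affinely independent
(`CircuitNormMinimiser.exists_equalising_point`).  What was left open there («Not formalised:
uniqueness of the minimiser») is settled here, together with the source's corollary on real zeros:

* `circuitNumber_mul_prod_rpow_eq_sum_iff` — the EQUALITY CASE of the weighted AM/GM step: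
  `Θ ∏ t_j^{λ_j} = ∑ b_j t_j` iff `b_j t_j = λ_j ∑_k b_k t_k` for every `j` (Mathlib's
  `Real.geom_mean_eq_arith_mean_weighted_iff_of_pos'`);
* `sum_exp_eq_circuitNumber_mul_exp_iff`, `signomial_boundary_eq_zero_iff`,
  `signomial_eq_min_iff`, `circuitNumber_mul_exp_lt_sum` — the zeros of the boundary signomial
  `g_{−Θ}` (equivalently, the points where `g_c(x) = (Θ + c) e^{β·x}` attains its lower bound) are
  EXACTLY the equalising points; off them the AM/GM inequality is strict;
* `eq_zero_of_forall_sub_dotProduct_eq_zero`, `equalisingPoint_unique`,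
  `existsUnique_equalisingPoint`, `existsUnique_signomial_boundary_zero`,
  `signomial_boundary_pos_of_ne` — for a FULL-DIMENSIONAL circuit (`#ι = n + 1` affinely
  independent outer exponents, i.e. `conv A` is an `n`-simplex, the source's standing hypothesis)
  the equalising point is unique, so `g_{−Θ}` has exactly one zero `s*` on `ℝⁿ` and is positive
  elsewhere: Proposition 13 in full («a root and the unique global minimizer»);
* `abs_eq_exp_of_circuitPolynomial_eq_zero`, `circuitPolynomial_zero_eq_or`,
  `exists_finset_circuitPolynomial_zeros` — Corollary 18: every real zero `x ∈ (ℝ ∖ 0)ⁿ` of a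
  boundary circuit polynomial (`|c| = Θ`) satisfies `|x_i| = e^{s*_i}`, so these zeros lie in an
  explicit set of at most `2ⁿ` sign patterns `(± e^{s*_1}, …, ± e^{s*_n})`;
  `inner_exponent_ne_zero` and `ne_zero_of_circuitPolynomial_eq_zero` show that when a constant
  term is present (`0 ∈ A`, as in the source's `P_Δ^y`) no zero has a vanishing coordinate, so the
  bound covers ALL affine real zeros (`exists_finset_circuitPolynomial_zeros'`).

All statements are fully proved; no named facts are introduced.  Not formalised: that the bound
`2ⁿ` is attained (the Motzkin example's four zeros `(±1, ±1)`; the tree's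
`MotzkinNotSumOfSquares` / `CircuitNumberNonnegativity` treat that polynomial), and the
strict-convexity proof route of the source (we use the AM/GM equality case instead of
[IlimanDewolff2016, Prop. (ExtremalPoint)]).
-/

namespace Literature.Algebra.Polynomial.CircuitBoundaryZeros

open Finset Matrix Literature.Algebra.Polynomial.CircuitNumberNonnegativity
open Literature.Algebra.Polynomial.CircuitNumberTightness
open Literature.Algebra.Polynomial.CircuitNormMinimiser

/-! ### The equality case of the AM/GM step -/

section CircuitNumber

variable {ι : Type*} [Fintype ι]

/-- **Equality in the circuit AM/GM inequality.**  For `b, λ, t > 0` with `∑ λ_j = 1`: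
`Θ(b, λ) ∏_j t_j^{λ_j} = ∑_j b_j t_j` iff `b_j t_j = λ_j · ∑_k b_k t_k` for every `j` (all the
quantities `b_j t_j / λ_j` are equal).  This is the equality case of
`CircuitNumberNonnegativity.circuitNumber_mul_prod_rpow_le`.
[cite: IlimanDewolff2016, Proposition 13 (uniqueness of the minimiser; here via the equality case
of the weighted AM/GM inequality)]
[cite: ChandrasekaranShah2016, §2.1, inequality (i) (its equality case)] -/
theorem circuitNumber_mul_prod_rpow_eq_sum_iff {b w : ι → ℝ} (hb : ∀ j, 0 < b j)
    (hw : ∀ j, 0 < w j) (hw1 : ∑ j, w j = 1) {t : ι → ℝ} (ht : ∀ j, 0 < t j) :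
    circuitNumber b w * ∏ j, t j ^ w j = ∑ j, b j * t j ↔
      ∀ j, b j * t j = w j * ∑ k, b k * t k := by
  have hz : ∀ j ∈ (univ : Finset ι), 0 ≤ b j * t j / w j :=
    fun j _ => div_nonneg (mul_nonneg (hb j).le (ht j).le) (hw j).le
  have key := Real.geom_mean_eq_arith_mean_weighted_iff_of_pos' univ w
    (fun j => b j * t j / w j) (fun j _ => hw j) hw1 hz
  have hL : circuitNumber b w * ∏ j, t j ^ w j = ∏ j, (b j * t j / w j) ^ w j := by
    rw [circuitNumber, ← prod_mul_distrib]
    refine prod_congr rfl fun j _ => ?_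
    rw [← Real.mul_rpow (div_nonneg (hb j).le (hw j).le) (ht j).le, div_mul_eq_mul_div]
  have hR : ∑ j, w j * (b j * t j / w j) = ∑ j, b j * t j :=
    sum_congr rfl fun j _ => by rw [mul_div_assoc', mul_div_cancel_left₀ _ (hw j).ne']
  rw [hL, ← hR, key, hR]
  simp only [mem_univ, true_implies]
  refine forall_congr' fun j => ?_
  rw [div_eq_iff (hw j).ne', mul_comm (w j)]

end CircuitNumber

/-! ### Zeros of the boundary signomial are exactly the equalising points -/

section Signomial

variable {ι : Type*} [Fintype ι] {n : Type*} [Fintype n]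

/-- **The AM/GM bound is attained exactly at the equalising points**: for `b, λ > 0`,
`∑ λ_j = 1`, `β = ∑ λ_j α(j)` and any `x ∈ ℝⁿ`,
`∑_j b_j e^{α(j)·x} = Θ e^{β·x}` iff `b_j e^{α(j)·x} = λ_j Θ e^{β·x}` for every `j`.
[cite: IlimanDewolff2016, Proposition 13 («s* … is a root and the unique global minimizer of
f(e^w)» — the root/minimum is attained only where the AM/GM step is an equality)] -/
theorem sum_exp_eq_circuitNumber_mul_exp_iff {b w : ι → ℝ} (hb : ∀ j, 0 < b j)
    (hw : ∀ j, 0 < w j) (hw1 : ∑ j, w j = 1) {α : ι → n → ℝ} {β : n → ℝ}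
    (hβ : ∀ i, β i = ∑ j, w j * α j i) (x : n → ℝ) :
    ∑ j, b j * Real.exp (α j ⬝ᵥ x) = circuitNumber b w * Real.exp (β ⬝ᵥ x) ↔
      ∀ j, b j * Real.exp (α j ⬝ᵥ x) = w j * circuitNumber b w * Real.exp (β ⬝ᵥ x) := by
  have hiff := circuitNumber_mul_prod_rpow_eq_sum_iff hb hw hw1
    (t := fun j => Real.exp (α j ⬝ᵥ x)) fun j => Real.exp_pos _
  rw [← exp_dotProduct_eq_prod_rpow hβ x] at hiff
  constructor
  · intro h j
    rw [hiff.mp h.symm j, h, mul_assoc]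
  · intro h
    simpa only [zero_mul, add_zero] using signomial_eq_at_equalising_point hw1 0 h

/-- **Zeros of the boundary signomial** `g_{−Θ}(x) = ∑_j b_j e^{α(j)·x} − Θ e^{β·x}`:
`g_{−Θ}(x) = 0` iff `x` is an equalising point.
[cite: IlimanDewolff2016, Proposition 13 («the point s* is a root … of f(e^w)» for c = −Θ_f)] -/
theorem signomial_boundary_eq_zero_iff {b w : ι → ℝ} (hb : ∀ j, 0 < b j) (hw : ∀ j, 0 < w j)
    (hw1 : ∑ j, w j = 1) {α : ι → n → ℝ} {β : n → ℝ} (hβ : ∀ i, β i = ∑ j, w j * α j i)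
    (x : n → ℝ) :
    ∑ j, b j * Real.exp (α j ⬝ᵥ x) + -circuitNumber b w * Real.exp (β ⬝ᵥ x) = 0 ↔
      ∀ j, b j * Real.exp (α j ⬝ᵥ x) = w j * circuitNumber b w * Real.exp (β ⬝ᵥ x) := by
  rw [← sum_exp_eq_circuitNumber_mul_exp_iff hb hw hw1 hβ x, neg_mul, ← sub_eq_add_neg,
    sub_eq_zero]

/-- For general `c`: the lower bound `g_c(x) ≥ (Θ + c) e^{β·x}`
(`CircuitNumberTightness.circuitNumber_mul_exp_le`) is attained at `x` iff `x` is an equalising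
point — `e^{s*}` minimises `(f / x^y)(e^w)` for every `c`, and nothing else does.
[cite: IlimanDewolff2016, Corollary 15 («e^{s*} is a global minimizer for (f / x^y)(e^w)
independent of the choice of c») and Proposition 13 (uniqueness)] -/
theorem signomial_eq_min_iff {b w : ι → ℝ} (hb : ∀ j, 0 < b j) (hw : ∀ j, 0 < w j)
    (hw1 : ∑ j, w j = 1) {α : ι → n → ℝ} {β : n → ℝ} (hβ : ∀ i, β i = ∑ j, w j * α j i)
    (c : ℝ) (x : n → ℝ) :
    ∑ j, b j * Real.exp (α j ⬝ᵥ x) + c * Real.exp (β ⬝ᵥ x)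
        = (circuitNumber b w + c) * Real.exp (β ⬝ᵥ x) ↔
      ∀ j, b j * Real.exp (α j ⬝ᵥ x) = w j * circuitNumber b w * Real.exp (β ⬝ᵥ x) := by
  rw [← sum_exp_eq_circuitNumber_mul_exp_iff hb hw hw1 hβ x, add_mul]
  constructor <;> intro h <;> linarith

/-- **Strict AM/GM off the equalising set**: if `x` is not an equalising point then
`Θ e^{β·x} < ∑_j b_j e^{α(j)·x}`, i.e. `g_c(x) > (Θ + c) e^{β·x}`.
[cite: IlimanDewolff2016, Proposition 13 («the unique global minimizer»)] -/
theorem circuitNumber_mul_exp_lt_sum {b w : ι → ℝ} (hb : ∀ j, 0 < b j) (hw : ∀ j, 0 < w j)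
    (hw1 : ∑ j, w j = 1) {α : ι → n → ℝ} {β : n → ℝ} (hβ : ∀ i, β i = ∑ j, w j * α j i)
    {x : n → ℝ}
    (hx : ¬ ∀ j, b j * Real.exp (α j ⬝ᵥ x) = w j * circuitNumber b w * Real.exp (β ⬝ᵥ x)) :
    circuitNumber b w * Real.exp (β ⬝ᵥ x) < ∑ j, b j * Real.exp (α j ⬝ᵥ x) :=
  lt_of_le_of_ne
    (circuitNumber_mul_exp_le (fun j => (hb j).le) (fun j => (hw j).le) hw1 hβ x)
    fun h => hx ((sum_exp_eq_circuitNumber_mul_exp_iff hb hw hw1 hβ x).mp h.symm)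

end Signomial

/-! ### Full-dimensional circuits: the equalising point is unique -/

section Unique

variable {ι : Type*} [Fintype ι] {n : Type*} [Fintype n]

/-- Linear algebra of a full-dimensional simplex: if `#ι = n + 1` points `α(j) ∈ ℝⁿ` are
affinely independent then the differences `α(j) − α(j₀)` span `ℝⁿ`, so a vector orthogonal to
all of them vanishes.  (This is the «rank n» of the linear system defining `s*_f`.)
[cite: IlimanDewolff2016, §3.2 («the rank of this system has to be n, since conv(A) is a
simplex»; s*_f is «the unique vector satisfying» it)] -/
theorem eq_zero_of_forall_sub_dotProduct_eq_zero {α : ι → n → ℝ} (hα : AffineIndependent ℝ α)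
    (hcard : Fintype.card ι = Fintype.card n + 1) (j₀ : ι) {d : n → ℝ}
    (hd : ∀ j, (α j - α j₀) ⬝ᵥ d = 0) : d = 0 := by
  have htop : affineSpan ℝ (Set.range α) = ⊤ :=
    hα.affineSpan_eq_top_iff_card_eq_finrank_add_one.mpr
      (by rw [Module.finrank_fintype_fun_eq_card]; exact hcard)
  have hv : Submodule.span ℝ (Set.range fun j => α j - α j₀) = ⊤ := by
    have h := AffineSubspace.vectorSpan_eq_top_of_affineSpan_eq_top (k := ℝ) (V := n → ℝ)
      (P := n → ℝ) htop
    rw [vectorSpan_range_eq_span_range_vsub_right (k := ℝ) α j₀] at h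
    simpa only [vsub_eq_sub] using h
  have key : ∀ u ∈ Submodule.span ℝ (Set.range fun j => α j - α j₀), u ⬝ᵥ d = 0 := by
    intro u hu
    induction hu using Submodule.span_induction with
    | mem u hu =>
        obtain ⟨j, rfl⟩ := hu
        exact hd j
    | zero => exact zero_dotProduct d
    | add u v _ _ hu hv => rw [add_dotProduct, hu, hv, add_zero]
    | smul r u _ hu => rw [smul_dotProduct, hu, smul_zero]
  exact dotProduct_self_eq_zero.mp (key d (by rw [hv]; exact Submodule.mem_top))

/-- **Uniqueness of the equalising point / norm minimiser** for a full-dimensional circuit: if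
`#ι = n + 1` outer exponents are affinely independent (so `conv A` is an `n`-simplex) and
`b, λ > 0`, then two equalising points coincide.  (Dividing the `j`-th by the `j₀`-th equalising
condition gives `e^{(α(j)−α(j₀))·x} = λ_j b_{j₀} / (b_j λ_{j₀})`, which determines
`(α(j) − α(j₀))·x` for all `j`, hence `x`.)
[cite: IlimanDewolff2016, §3.2 (s*_f «the unique vector satisfying» the system) and
Proposition 13 («the unique global minimizer»)] -/
theorem equalisingPoint_unique {b w : ι → ℝ} (hb : ∀ j, 0 < b j) (hw : ∀ j, 0 < w j)
    {α : ι → n → ℝ} (hα : AffineIndependent ℝ α) (hcard : Fintype.card ι = Fintype.card n + 1)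
    {β : n → ℝ} {x x' : n → ℝ}
    (hx : ∀ j, b j * Real.exp (α j ⬝ᵥ x) = w j * circuitNumber b w * Real.exp (β ⬝ᵥ x))
    (hx' : ∀ j, b j * Real.exp (α j ⬝ᵥ x') = w j * circuitNumber b w * Real.exp (β ⬝ᵥ x')) :
    x = x' := by
  obtain ⟨j₀⟩ : Nonempty ι := Fintype.card_pos_iff.mp (by omega)
  have hlog : ∀ (y : n → ℝ),
      (∀ j, b j * Real.exp (α j ⬝ᵥ y) = w j * circuitNumber b w * Real.exp (β ⬝ᵥ y)) →
      ∀ j, Real.exp (α j ⬝ᵥ y - α j₀ ⬝ᵥ y) = w j * b j₀ / (b j * w j₀) := by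
    intro y hy j
    have h1 : b j * Real.exp (α j ⬝ᵥ y) * w j₀ = w j * (b j₀ * Real.exp (α j₀ ⬝ᵥ y)) := by
      rw [hy j, hy j₀]; ring
    rw [Real.exp_sub, div_eq_div_iff (Real.exp_pos _).ne' (mul_pos (hb j) (hw j₀)).ne']
    linear_combination h1
  have key : ∀ j, (α j - α j₀) ⬝ᵥ (x - x') = 0 := by
    intro j
    have h := Real.exp_eq_exp.mp ((hlog x hx j).trans (hlog x' hx' j).symm)
    rw [sub_dotProduct, dotProduct_sub, dotProduct_sub]
    linarith
  exact sub_eq_zero.mp (eq_zero_of_forall_sub_dotProduct_eq_zero hα hcard j₀ key)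

/-- **Existence and uniqueness of the norm minimiser** (full-dimensional circuit, `b, λ > 0`,
`∑ λ_j = 1`, `β = ∑ λ_j α(j)`): there is exactly one equalising point.
[cite: IlimanDewolff2016, §3.2 («we define s*_f ∈ ℝⁿ as the unique vector satisfying …»;
«s*_f indeed is well defined»)] -/
theorem existsUnique_equalisingPoint {b w : ι → ℝ} (hb : ∀ j, 0 < b j) (hw : ∀ j, 0 < w j)
    (hw1 : ∑ j, w j = 1) {α : ι → n → ℝ} (hα : AffineIndependent ℝ α)
    (hcard : Fintype.card ι = Fintype.card n + 1) {β : n → ℝ}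
    (hβ : ∀ i, β i = ∑ j, w j * α j i) :
    ∃! x : n → ℝ, ∀ j, b j * Real.exp (α j ⬝ᵥ x)
      = w j * circuitNumber b w * Real.exp (β ⬝ᵥ x) := by
  obtain ⟨x, hx⟩ := exists_equalising_point hb hw hw1 hα hβ
  exact ⟨x, hx, fun y hy => equalisingPoint_unique hb hw hα hcard hy hx⟩

/-- **Proposition 13 in full**: for a full-dimensional circuit with `b, λ > 0` and `c = −Θ`, the
boundary signomial `g_{−Θ}(x) = ∑_j b_j e^{α(j)·x} − Θ e^{β·x}` has EXACTLY ONE zero on `ℝⁿ` (the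
norm minimiser `s*`).
[cite: IlimanDewolff2016, Proposition 13 («For f ∈ P_Δ^y and c = −Θ_f the point s* ∈ ℝⁿ is a
root and the unique global minimizer of f(e^w)»)] -/
theorem existsUnique_signomial_boundary_zero {b w : ι → ℝ} (hb : ∀ j, 0 < b j)
    (hw : ∀ j, 0 < w j) (hw1 : ∑ j, w j = 1) {α : ι → n → ℝ} (hα : AffineIndependent ℝ α)
    (hcard : Fintype.card ι = Fintype.card n + 1) {β : n → ℝ}
    (hβ : ∀ i, β i = ∑ j, w j * α j i) :
    ∃! x : n → ℝ,
      ∑ j, b j * Real.exp (α j ⬝ᵥ x) + -circuitNumber b w * Real.exp (β ⬝ᵥ x) = 0 := by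
  obtain ⟨x, hx, huniq⟩ := existsUnique_equalisingPoint hb hw hw1 hα hcard hβ
  exact ⟨x, (signomial_boundary_eq_zero_iff hb hw hw1 hβ x).mpr hx,
    fun y hy => huniq y ((signomial_boundary_eq_zero_iff hb hw hw1 hβ y).mp hy)⟩

/-- … and `g_{−Θ}` is POSITIVE at every other point: `s*` is the unique global minimiser (minimum
value `0`).
[cite: IlimanDewolff2016, Proposition 13 («the unique global minimizer of f(e^w)»)] -/
theorem signomial_boundary_pos_of_ne {b w : ι → ℝ} (hb : ∀ j, 0 < b j) (hw : ∀ j, 0 < w j)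
    (hw1 : ∑ j, w j = 1) {α : ι → n → ℝ} (hα : AffineIndependent ℝ α)
    (hcard : Fintype.card ι = Fintype.card n + 1) {β : n → ℝ}
    (hβ : ∀ i, β i = ∑ j, w j * α j i) {s : n → ℝ}
    (hs : ∀ j, b j * Real.exp (α j ⬝ᵥ s) = w j * circuitNumber b w * Real.exp (β ⬝ᵥ s))
    {x : n → ℝ} (hx : x ≠ s) :
    0 < ∑ j, b j * Real.exp (α j ⬝ᵥ x) + -circuitNumber b w * Real.exp (β ⬝ᵥ x) := by
  have hne : ¬ ∀ j, b j * Real.exp (α j ⬝ᵥ x)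
      = w j * circuitNumber b w * Real.exp (β ⬝ᵥ x) :=
    fun h => hx (equalisingPoint_unique hb hw hα hcard h hs)
  have h := circuitNumber_mul_exp_lt_sum hb hw hw1 hβ hne
  linarith

end Unique

/-! ### Real zeros of boundary circuit polynomials ([IlimanDewolff2016], Corollary 18) -/

section Polynomial

variable {ι : Type*} [Fintype ι] {n : Type*} [Fintype n]

/-- **Zeros in `(ℝ ∖ 0)ⁿ` of a boundary circuit polynomial.**  Let
`p = ∑_j b_j x^{a(j)} + c x^β` be a circuit polynomial on a full-dimensional circuit (`#ι = n + 1`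
affinely independent even outer exponents `a(j)`, `b > 0`, `β = ∑ λ_j a(j)` with `λ > 0`,
`∑ λ_j = 1`) lying on the boundary `|c| = Θ`, and let `s*` be the norm minimiser (the equalising
point).  Then every real zero `x` of `p` with all coordinates nonzero satisfies `|x_i| = e^{s*_i}`.
(With `y_i = log |x_i|`: `p(x) = 0` forces `∑ b_j e^{a(j)·y} = |c| e^{β·y} = Θ e^{β·y}`, so `y` is
an equalising point, hence `y = s*`.)
[cite: IlimanDewolff2016, Corollary 18 (arXiv numbering; «which all satisfy |x_j| = e^{s_j^*}»,
proof: «we know by the proof of Theorem (Thm:Positiv) that |x_j| = e^{s_j^*}»)] -/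
theorem abs_eq_exp_of_circuitPolynomial_eq_zero {b w : ι → ℝ} (hb : ∀ j, 0 < b j)
    (hw : ∀ j, 0 < w j) (hw1 : ∑ j, w j = 1) {a : ι → n → ℕ} (ha : ∀ j i, Even (a j i))
    (hα : AffineIndependent ℝ (fun j i => (a j i : ℝ)))
    (hcard : Fintype.card ι = Fintype.card n + 1) {β : n → ℕ}
    (hβ : ∀ i, (β i : ℝ) = ∑ j, w j * a j i) {c : ℝ} (hc : |c| = circuitNumber b w)
    {s : n → ℝ} (hs : ∀ j, b j * Real.exp ((fun i => (a j i : ℝ)) ⬝ᵥ s)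
      = w j * circuitNumber b w * Real.exp ((fun i => (β i : ℝ)) ⬝ᵥ s))
    {x : n → ℝ} (hx0 : ∀ i, x i ≠ 0)
    (hx : ∑ j, b j * ∏ i, x i ^ a j i + c * ∏ i, x i ^ β i = 0) (i : n) :
    |x i| = Real.exp (s i) := by
  set y : n → ℝ := fun i => Real.log |x i| with hy_def
  have hy : ∀ i, Real.exp (y i) = |x i| := fun i => Real.exp_log (abs_pos.mpr (hx0 i))
  have hout : ∀ j, ∏ i, x i ^ a j i = Real.exp ((fun i => (a j i : ℝ)) ⬝ᵥ y) := by
    intro j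
    rw [← prod_exp_pow_eq_exp_dotProduct]
    exact prod_congr rfl fun i _ => by rw [hy, Even.pow_abs (ha j i)]
  have hin : |∏ i, x i ^ β i| = Real.exp ((fun i => (β i : ℝ)) ⬝ᵥ y) := by
    rw [← prod_exp_pow_eq_exp_dotProduct, Finset.abs_prod]
    exact prod_congr rfl fun i _ => by rw [abs_pow, hy]
  have hS : 0 ≤ ∑ j, b j * Real.exp ((fun i => (a j i : ℝ)) ⬝ᵥ y) :=
    sum_nonneg fun j _ => mul_nonneg (hb j).le (Real.exp_pos _).le
  have hsum : ∑ j, b j * Real.exp ((fun i => (a j i : ℝ)) ⬝ᵥ y)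
      = circuitNumber b w * Real.exp ((fun i => (β i : ℝ)) ⬝ᵥ y) := by
    simp_rw [hout] at hx
    have h1 : c * ∏ i, x i ^ β i = -∑ j, b j * Real.exp ((fun i => (a j i : ℝ)) ⬝ᵥ y) := by
      linarith
    have h2 := congrArg abs h1
    rw [abs_mul, hc, hin, abs_neg, abs_of_nonneg hS] at h2
    exact h2.symm
  have heq := (sum_exp_eq_circuitNumber_mul_exp_iff hb hw hw1 hβ y).mp hsum
  rw [← hy, equalisingPoint_unique hb hw hα hcard heq hs]

/-- Consequently such a zero is a sign pattern of the norm minimiser: `x_i = ± e^{s*_i}`.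
[cite: IlimanDewolff2016, Corollary 18 (proof: «Thus, x = (± e^{s_1^*}, …, ± e^{s_n^*})»)] -/
theorem circuitPolynomial_zero_eq_or {b w : ι → ℝ} (hb : ∀ j, 0 < b j) (hw : ∀ j, 0 < w j)
    (hw1 : ∑ j, w j = 1) {a : ι → n → ℕ} (ha : ∀ j i, Even (a j i))
    (hα : AffineIndependent ℝ (fun j i => (a j i : ℝ)))
    (hcard : Fintype.card ι = Fintype.card n + 1) {β : n → ℕ}
    (hβ : ∀ i, (β i : ℝ) = ∑ j, w j * a j i) {c : ℝ} (hc : |c| = circuitNumber b w)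
    {s : n → ℝ} (hs : ∀ j, b j * Real.exp ((fun i => (a j i : ℝ)) ⬝ᵥ s)
      = w j * circuitNumber b w * Real.exp ((fun i => (β i : ℝ)) ⬝ᵥ s))
    {x : n → ℝ} (hx0 : ∀ i, x i ≠ 0)
    (hx : ∑ j, b j * ∏ i, x i ^ a j i + c * ∏ i, x i ^ β i = 0) (i : n) :
    x i = Real.exp (s i) ∨ x i = -Real.exp (s i) :=
  (abs_eq (Real.exp_pos _).le).mp
    (abs_eq_exp_of_circuitPolynomial_eq_zero hb hw hw1 ha hα hcard hβ hc hs hx0 hx i)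

/-- **At most `2ⁿ` zeros in `(ℝ ∖ 0)ⁿ`**: the zeros of a boundary circuit polynomial with all
coordinates nonzero lie in the finite set `{(ε_i e^{s*_i})_i : ε ∈ {±1}ⁿ}`, of cardinality at most
`2ⁿ`.
[cite: IlimanDewolff2016, Corollary 18 («f has at most 2ⁿ affine real zeros v ∈ ℝⁿ, which all
satisfy |x_j| = e^{s_j^*}»)] -/
theorem exists_finset_circuitPolynomial_zeros {b w : ι → ℝ} (hb : ∀ j, 0 < b j)
    (hw : ∀ j, 0 < w j) (hw1 : ∑ j, w j = 1) {a : ι → n → ℕ} (ha : ∀ j i, Even (a j i))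
    (hα : AffineIndependent ℝ (fun j i => (a j i : ℝ)))
    (hcard : Fintype.card ι = Fintype.card n + 1) {β : n → ℕ}
    (hβ : ∀ i, (β i : ℝ) = ∑ j, w j * a j i) {c : ℝ} (hc : |c| = circuitNumber b w)
    {s : n → ℝ} (hs : ∀ j, b j * Real.exp ((fun i => (a j i : ℝ)) ⬝ᵥ s)
      = w j * circuitNumber b w * Real.exp ((fun i => (β i : ℝ)) ⬝ᵥ s)) :
    ∃ S : Finset (n → ℝ), S.card ≤ 2 ^ Fintype.card n ∧
      ∀ x : n → ℝ, (∀ i, x i ≠ 0) →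
        ∑ j, b j * ∏ i, x i ^ a j i + c * ∏ i, x i ^ β i = 0 → x ∈ S := by
  classical
  refine ⟨(univ : Finset (n → Bool)).image
      fun ε i => if ε i then Real.exp (s i) else -Real.exp (s i), ?_, ?_⟩
  · refine card_image_le.trans ?_
    rw [card_univ, Fintype.card_fun, Fintype.card_bool]
  · intro x hx0 hx
    have h := circuitPolynomial_zero_eq_or hb hw hw1 ha hα hcard hβ hc hs hx0 hx
    refine mem_image.mpr ⟨fun i => decide (x i = Real.exp (s i)), mem_univ _, ?_⟩
    funext i
    simp only [decide_eq_true_eq]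
    split_ifs with h2
    · exact h2.symm
    · rcases h i with h1 | h1
      · exact absurd h1 h2
      · exact h1.symm

/-- For a full-dimensional circuit every variable occurs in the inner monomial: `β_i ≠ 0` for all
`i` (if `β_i = 0` then all `a(j)_i = 0`, and the `i`-th unit vector would be orthogonal to every
difference `a(j) − a(j₀)`, contradicting that these span `ℝⁿ`).
[cite: IlimanDewolff2016, §3.2 («conv(A) is a simplex» with y ∈ int(conv A); rank n)] -/
theorem inner_exponent_ne_zero {w : ι → ℝ} (hw : ∀ j, 0 < w j) {a : ι → n → ℕ}
    (hα : AffineIndependent ℝ (fun j i => (a j i : ℝ)))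
    (hcard : Fintype.card ι = Fintype.card n + 1) {β : n → ℕ}
    (hβ : ∀ i, (β i : ℝ) = ∑ j, w j * a j i) (i : n) : β i ≠ 0 := by
  classical
  intro hβi
  have hall : ∀ j, (a j i : ℝ) = 0 := by
    have hsum : ∑ j, w j * (a j i : ℝ) = 0 := by rw [← hβ, hβi, Nat.cast_zero]
    have h := (sum_eq_zero_iff_of_nonneg fun j _ =>
      mul_nonneg (hw j).le (Nat.cast_nonneg (a j i))).mp hsum
    intro j
    rcases mul_eq_zero.mp (h j (mem_univ j)) with h0 | h0
    · exact absurd h0 (hw j).ne'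
    · exact h0
  obtain ⟨j₀⟩ : Nonempty ι := Fintype.card_pos_iff.mp (by omega)
  have key := eq_zero_of_forall_sub_dotProduct_eq_zero hα hcard j₀ (d := Pi.single i 1)
    fun j => by rw [dotProduct_single, Pi.sub_apply, hall j, hall j₀, sub_zero, zero_mul]
  have h1 := congrFun key i
  simp at h1

/-- **No zero has a vanishing coordinate when a constant term is present.**  If some outer
exponent is `a(j₀) = 0` (the source's setting `0 ∈ A`, `P_Δ^y`), `b > 0`, all `a(j)` are even
and every `β_i ≠ 0`, then a real zero of `p = ∑ b_j x^{a(j)} + c x^β` has all coordinates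
nonzero: otherwise `x^β = 0` and `p(x) ≥ b_{j₀} > 0`.
[cite: IlimanDewolff2016, Corollary 18 (its setting f ∈ ∂P_{n,2d}^y ⊆ P_Δ^y, where
«α(0) = 0»; proof «|x_j| = e^{s_j^*}» for every affine real zero)] -/
theorem ne_zero_of_circuitPolynomial_eq_zero {b : ι → ℝ} (hb : ∀ j, 0 < b j) {a : ι → n → ℕ}
    (ha : ∀ j i, Even (a j i)) {j₀ : ι} (hj₀ : ∀ i, a j₀ i = 0) {β : n → ℕ}
    (hβ0 : ∀ i, β i ≠ 0) {c : ℝ} {x : n → ℝ}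
    (hx : ∑ j, b j * ∏ i, x i ^ a j i + c * ∏ i, x i ^ β i = 0) (i : n) : x i ≠ 0 := by
  intro hxi
  have hβprod : ∏ k, x k ^ β k = 0 :=
    prod_eq_zero (mem_univ i) (by rw [hxi, zero_pow (hβ0 i)])
  rw [hβprod, mul_zero, add_zero] at hx
  have hle : b j₀ * ∏ k, x k ^ a j₀ k ≤ ∑ j, b j * ∏ k, x k ^ a j k :=
    single_le_sum (f := fun j => b j * ∏ k, x k ^ a j k)
      (fun j _ => mul_nonneg (hb j).le (prod_nonneg fun k _ => (ha j k).pow_nonneg _))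
      (mem_univ j₀)
  simp only [hj₀, pow_zero, prod_const_one, mul_one] at hle
  linarith [hb j₀]

/-- **Corollary 18 in the source's setting** (constant term present, full-dimensional circuit,
`|c| = Θ`): ALL affine real zeros of `p` are sign patterns `(± e^{s*_1}, …, ± e^{s*_n})` of the
norm minimiser; in particular there are at most `2ⁿ` of them.
[cite: IlimanDewolff2016, Corollary 18 («Let f ∈ ∂P_{n,2d}^y. Then f has at most 2ⁿ affine real
zeros v ∈ ℝⁿ, which all satisfy |x_j| = e^{s_j^*}»)] -/
theorem exists_finset_circuitPolynomial_zeros' {b w : ι → ℝ} (hb : ∀ j, 0 < b j)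
    (hw : ∀ j, 0 < w j) (hw1 : ∑ j, w j = 1) {a : ι → n → ℕ} (ha : ∀ j i, Even (a j i))
    {j₀ : ι} (hj₀ : ∀ i, a j₀ i = 0) (hα : AffineIndependent ℝ (fun j i => (a j i : ℝ)))
    (hcard : Fintype.card ι = Fintype.card n + 1) {β : n → ℕ}
    (hβ : ∀ i, (β i : ℝ) = ∑ j, w j * a j i) {c : ℝ} (hc : |c| = circuitNumber b w)
    {s : n → ℝ} (hs : ∀ j, b j * Real.exp ((fun i => (a j i : ℝ)) ⬝ᵥ s)
      = w j * circuitNumber b w * Real.exp ((fun i => (β i : ℝ)) ⬝ᵥ s)) :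
    ∃ S : Finset (n → ℝ), S.card ≤ 2 ^ Fintype.card n ∧
      ∀ x : n → ℝ, ∑ j, b j * ∏ i, x i ^ a j i + c * ∏ i, x i ^ β i = 0 →
        (∀ i, x i = Real.exp (s i) ∨ x i = -Real.exp (s i)) ∧ x ∈ S := by
  obtain ⟨S, hS, hmem⟩ := exists_finset_circuitPolynomial_zeros hb hw hw1 ha hα hcard hβ hc hs
  have hβ0 := inner_exponent_ne_zero hw hα hcard hβ
  refine ⟨S, hS, fun x hx => ?_⟩
  have hx0 : ∀ i, x i ≠ 0 := ne_zero_of_circuitPolynomial_eq_zero hb ha hj₀ hβ0 hx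
  exact ⟨circuitPolynomial_zero_eq_or hb hw hw1 ha hα hcard hβ hc hs hx0 hx, hmem x hx0 hx⟩

end Polynomial

end Literature.Algebra.Polynomial.CircuitBoundaryZeros
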